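import Summits.ValiantsHypothesis.ValiantsHypothesis.Theorems.LacunarySymmetroidMatrixDescartesFiniteSectorRealisableSixThree
import Summits.ValiantsHypothesis.ValiantsHypothesis.Theorems.LacunarySymmetroidMatrixDescartesFiniteSectorEtaTwoSix
import Summits.ValiantsHypothesis.ValiantsHypothesis.Theorems.LacunarySymmetroidMatrixDescartesFiniteSectorEtaKThreeSixSeven
import Summits.ValiantsHypothesis.ValiantsHypothesis.Theorems.LacunarySymmetroidMatrixDescartesFiniteSectorStampCeilingKThree

/-!
# `MatrixDescartes` — line «finite»: the `(6,3)` cell is EXACT on both sides in both currencies: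
# `ν(6,3) = 18` and `η(6,3) = 36` (by name)

HONEST FRAMING.  Object-search cell `pub-symmetroid`, seat val-sym-eng-3 g5 (census/instrument engine #3).  HELPER of
the crux item `stmt-ValiantsHypothesis-18050` (`Theses.LacunarySymmetroid.MatrixDescartes`, asymptotic in `K`) with NO
closure claim — register bookkeeping only.  The seat's witness `fullyRealisable_six_014_eighteen`
(`…FiniteSectorRealisableSixThree`: a symmetric `6 × 6` half-pencil on the Stöhr basis `(0,1,4)` with a full-positive-rooted
determinant of degree `18`) is read against the kernel ceilings of the `K = 3` column:

* stamp currency: `stampLawAt_six_three : StampLawAt 6 3 18` (`…FiniteSectorStampCeilingKThree`, T3) and, here,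
  `not_stampLawAt_six_three_17 : ¬ StampLawAt 6 3 17` — so **`ν(6,3) = 18 = n(6,2)`** exactly;
* sector currency: `hypRootLawAt_six_three_36 : HypRootLawAt 6 3 36` (`…FiniteSectorEtaKThreeSixSeven`, gap-rule sieve) and,
  here, `not_hypRootLawAt_six_three_35 : ¬ HypRootLawAt 6 3 35` by the PROVED doubling `u ↦ u²` (door-p5's adapter
  `not_hypRootLawAt_of_fullyRealisable`, T2: an in-sector `(6,3)` pencil on `(0,2,8)` of degree `36`) — so
  **`η(6,3) = 36 = σ(6,3)`** exactly.

With `(2,3)` (dense), F4, F5, `(5,3)` and this cell the `K = 3` column of the instrument table of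
`Cruxes/MatrixDescartes/Lines/finite.md` is exact on both sides, by name, for every `m ≤ 6`.  Nothing here bears on the crux
or on `VP ≠ VNP`.  [folklore] Descartes / postage-stamp bookkeeping; no citation exists or is needed.
-/

-- `Summit.ValiantsHypothesis.ValiantsHypothesis.…` repeats a component by the D-0017 layout
-- (single-conjunct summit), which the `dupNamespace` linter flags; the name is mandated.
set_option linter.dupNamespace false

namespace Summit.ValiantsHypothesis.ValiantsHypothesis.Theorems.LacunarySymmetroidMatrixDescartes.FiniteSector

/-- **`ν(6,3) = 18` is EXACT: the ceiling `17` fails** (witness `fullyRealisable_six_014_eighteen` on `(0,1,4)`). [folklore] -/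
theorem not_stampLawAt_six_three_17 : ¬ StampLawAt 6 3 17 := by
  intro h
  obtain ⟨S, hS, hfull, hdeg⟩ := fullyRealisable_six_014_eighteen
  have := h _ S hS hfull
  omega

/-- **`ν(6,3) = 18` EXACT on both sides** (Stöhr's `n(6,2) = 18`: ceiling `stampLawAt_six_three`, floor
`not_stampLawAt_six_three_17`). [folklore] -/
theorem nu_six_three_exact : StampLawAt 6 3 18 ∧ ¬ StampLawAt 6 3 17 :=
  ⟨stampLawAt_six_three, not_stampLawAt_six_three_17⟩

/-- **`η(6,3) ≥ 36`**: `¬ HypRootLawAt 6 3 35` — the doubled `(6,3)` realisation (`fullyRealisable_six_014_eighteen`): an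
in-sector (all roots real and simple) symmetric `(6,3)` pencil on `(0,2,8)` of degree `36` (adapter
`not_hypRootLawAt_of_fullyRealisable`, T2). [folklore] -/
theorem not_hypRootLawAt_six_three_35 : ¬ HypRootLawAt 6 3 35 :=
  not_hypRootLawAt_of_fullyRealisable fullyRealisable_six_014_eighteen (by norm_num)

/-- **`η(6,3) = 36` EXACT on both sides** (`σ(6,3) = 36 = 2·n(6,2)`: ceiling `hypRootLawAt_six_three_36`, floor
`not_hypRootLawAt_six_three_35`). [folklore] -/
theorem eta_six_three_exact : HypRootLawAt 6 3 36 ∧ ¬ HypRootLawAt 6 3 35 :=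
  ⟨hypRootLawAt_six_three_36, not_hypRootLawAt_six_three_35⟩

end Summit.ValiantsHypothesis.ValiantsHypothesis.Theorems.LacunarySymmetroidMatrixDescartes.FiniteSector
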